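import Summits.BirchSwinnertonDyer.Rank1Residual.X2.RankZeroConverse
import Literature.NumberTheory.EllipticCurves.Rank1Residual.Typed.WuthrichUpperBound
import HarnessLib

/-!
# Class X2, rank `0`: Mazur's main conjecture ⟺ `BSD(E,p)` at an odd multiplicative Eisenstein
# prime; the typed input of sub-cell X2b is EXACT; per-pair main-conjecture certificates
# (cell `b2b-bsdres`, unit `b2b-bsdres-eisenstein-p2`, gen 3)

HONEST FRAMING (run/shared/lean/b2b/bsd-rank1-residual/, verbatim in every file): the goal of the
cell is to DELETE the COMBINATION-SHAPED residual classes of the Birch–Swinnerton-Dyer formula for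
ALL analytic-rank `≤ 1` elliptic curves over `ℚ` — "full BSD formula for every rank `≤ 1` curve in
class `C`" assembled STRICTLY from published theorems — so that the rank-`≤ 1` remainder becomes
exactly the CONSTRUCTION-SHAPED classes, which are TYPED (missing-input `Prop`s), NOT attempted.
This is not "finishing BSD". Research routes; NO CLAIM BEYOND STATED CLASSES. Theorems only (no
definition, no named fact); companion of `X2/RankZeroConverse.lean` (the class-agnostic core: one
divisibility at an odd multiplicative prime + the reverse rank-`0` inequality ⟹ Mazur's main
conjecture at the pair, Greenberg LNM 1716 §4–5 made integral as in x11a gen 13's p201894) and of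
`X2/Cells.lean` / `X2/RankZero.lean` (gen 1: sub-cells X2a/X2b/X2c; typed input of X2b
`X2.MissingInputB W p := X2.MazurMainConjectureAt W p`; MC ⇒ `BSD(E,p)` in rank `0`).

* THE REDUCIBLE INSTANCE (Wuthrich 2014 Thm. 16, `hWu`, PUB, numbered, every `p > 2`, no (ram), no
  semistability away from `p`): `mazurMainConjectureAt_of_padicValRat_le_of_red`,
  `…_of_missingLowerBoundAt_of_red`, **`mazurMainConjectureAt_of_bsdp_of_red`** — at an odd
  multiplicative prime with `E[p]` reducible and `ord_{s=1}L(E,s) = 0`, `BSD(E,p)` ⟹ Mazur's main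
  conjecture at `(E,p)`.
* THE EQUIVALENCES `mazurMainConjectureAt_iff_bsdp_of_red`, `…_iff_missingLowerBoundAt_of_red`: on
  X2's whole rank-`0` half (X2a ∪ X2b, `p = 3` included) the main conjecture, Miller's `BSD(E,p)` and
  the lower bound `ord_p #Ш_an ≤ ord_p #Ш` coincide. CLASS LEVEL: `targetB_iff_forall_cellB_mazurMainConjectureAt`
  — sub-cell X2b's target of record ⟺ "Mazur's main conjecture at every X2b pair": the typed missing
  input `X2.MissingInputB` is EXACT (gen 1 had ⇐ only); `forall_rankZero_bsdp_iff_forall_mazurMainConjectureAt`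
  for the whole rank-`0` half.
* PER-PAIR MAIN-CONJECTURE CERTIFICATES from the published record, at pairs of the OTHER parity
  type (X2b: `¬GVPar`, where `μ(X) ≥ 1` is expected — Greenberg 1999 Prop. 5.7 / Greenberg–Vatsal
  result B — and nothing in print proves the main conjecture for a class of pairs):
  `mazurMainConjectureAt_of_shaAn_unit_of_red` (Wuthrich Prop. 21: every rank-`0` X2 pair with
  `p ∤ #Ш(E/ℚ)_an`), `mazurMainConjectureAt_of_cellB_of_shaAn_unit`; and the lower-bound form
  `cellB_bsdp_iff_missingLowerBoundAt`.

What this does NOT do: no class-level deletion; X2b stays CONSTRUCTION-SHAPED (its missing object is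
now known to be EXACTLY Mazur's main conjecture at a multiplicative Eisenstein prime of the other
parity type, `μ > 0` allowed — X2-GAP.md §3, §8); nothing in rank `1`.

References: [Wuthrich2014] Thm. 16, §5 (p. 397), Prop. 21 (p. 400); [GreenbergLNM1716] §4–5,
Thm. 1.5, Prop. 5.7; [SteinWuthrich2013] Thm. 6.1, §4.2; [GreenbergStevens1993];
[GreenbergVatsal2000] result B; [Skinner2016PacificMC] Thm. A (shape); [Miller2011LMS] Def. 1.1.
-/

set_option autoImplicit false

noncomputable section

open scoped Classical MatrixGroups ModularForm

open CongruenceSubgroup WeierstrassCurve Literature.NumberTheory.EllipticCurves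
  Literature.NumberTheory.EllipticCurves.ModularForms
  Literature.NumberTheory.EllipticCurves.Rank1Residual
  Literature.NumberTheory.EllipticCurves.Rank1Residual.Typed
  Literature.NumberTheory.EllipticCurves.Wuthrich2014
  Literature.NumberTheory.EllipticCurves.SteinWuthrich2013

namespace Summit.BirchSwinnertonDyer.Rank1Residual.X2

/-! ### The reducible instance: Wuthrich 2014 Thm. 16 -/

/-- **`BSD`-type lower bound ⟹ Mazur's main conjecture at an odd multiplicative prime with
`E[p]` REDUCIBLE, analytic rank `0` (core form).** The divisibility is Wuthrich 2014 Thm. 16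
(`hWu`, PUB, numbered): valid at EVERY `p > 2` — so `p = 3`, where 776 of the 843 X2 census pairs
below `10⁴` live, is in range —, NO semistability-away-from-`p` and NO (ram) hypothesis.
[cite: Wuthrich2014, Thm. 16 and §5 (p. 397)] [cite: GreenbergLNM1716, §4 (PDF pp. 112–113) and Thm. 1.5 (PDF p. 61)]
[cite: SteinWuthrich2013, Thm. 6.1 (p. 20) and §4.2] -/
theorem mazurMainConjectureAt_of_padicValRat_le_of_red
    (hWu : thm16_charIdeal_dvd_multiplicative_of_reducible)
    (hJs : thm61_splitMultiplicative) (hJn : thm61_nonsplitMultiplicative)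
    (hHs : exists_isSplitMultCanonical) (hHn : exists_isMultCanonical)
    (hGZK : rank_eq_analyticRank_of_analyticRank_le_one) (hmod : hasEntireLFunction_rat)
    (W : WeierstrassCurve ℚ) [W.IsElliptic] [W.IsGloballyMinimal] (p : ℕ) [Fact p.Prime]
    (hGS : greenberg_stevens (W := W) (p := p))
    (hp2 : p ≠ 2) (hmult : W.HasMultiplicativeReductionAtPrime p)
    (hred : ¬ W.HasIrreducibleModPGaloisRep p) (hr : W.analyticRank = 0)
    (hlow : ∀ t : ℚ, W.entireLFunction 1 / (W.realPeriodRat : ℂ) = (t : ℂ) →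
      padicValRat p t ≤ (padicValNat p W.shaOrder : ℤ) + padicValNat p W.tamagawaProduct -
        2 * padicValNat p W.torsionOrder) :
    X2.MazurMainConjectureAt W p :=
  mazurMainConjectureAt_of_divisibilityAt_of_padicValRat_le hJs hJn hHs hHn hGZK hmod W p hGS hp2
    hmult hr (fun _κ _γ hκ hγ hγ' _N _ _f hf D ϖ hϖ => hWu W p hp2 hmult hred hκ hγ hγ' hf D ϖ hϖ) hlow

/-- **`ord_p #Ш(E/ℚ)_an ≤ ord_p #Ш(E/ℚ)` ⟹ Mazur's main conjecture at `(E,p)`** (odd multiplicative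
`p`, `E[p]` reducible, analytic rank `0`; Wuthrich Thm. 16 + the rank-`0` facts). The hypothesis is
the cell's typed lower bound `Typed.MissingLowerBoundAt W p` — the located content of X2b's gap
(X2-GAP.md §3: "the LOWER bound ord_p #Ш_an ≤ ord_p #Ш is the content of the missing MC direction"),
now an EQUIVALENT of the main conjecture at the pair. [cite: Wuthrich2014, Thm. 16 (p. 397)]
[cite: GreenbergLNM1716, §4 (PDF pp. 112–113) and §5 (closing examples)] [cite: Miller2011LMS, Def. 1.1] -/
theorem mazurMainConjectureAt_of_missingLowerBoundAt_of_red
    (hWu : thm16_charIdeal_dvd_multiplicative_of_reducible)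
    (hJs : thm61_splitMultiplicative) (hJn : thm61_nonsplitMultiplicative)
    (hHs : exists_isSplitMultCanonical) (hHn : exists_isMultCanonical)
    (hGZK : rank_eq_analyticRank_of_analyticRank_le_one) (hmod : hasEntireLFunction_rat)
    (W : WeierstrassCurve ℚ) [W.IsElliptic] [W.IsGloballyMinimal] (p : ℕ) [Fact p.Prime]
    (hGS : greenberg_stevens (W := W) (p := p))
    (hp2 : p ≠ 2) (hmult : W.HasMultiplicativeReductionAtPrime p)
    (hred : ¬ W.HasIrreducibleModPGaloisRep p) (hr : W.analyticRank = 0)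
    (hlow : MissingLowerBoundAt W p) : X2.MazurMainConjectureAt W p :=
  mazurMainConjectureAt_of_divisibilityAt_of_missingLowerBoundAt hJs hJn hHs hHn hGZK hmod W p hGS
    hp2 hmult hr (fun _κ _γ hκ hγ hγ' _N _ _f hf D ϖ hϖ => hWu W p hp2 hmult hred hκ hγ hγ' hf D ϖ hϖ)
    hlow

/-- **`BSD(E,p)` ⟹ Mazur's main conjecture at `(E,p)` at an odd multiplicative EISENSTEIN prime,
analytic rank `0`** (Wuthrich 2014 Thm. 16 + Stein–Wuthrich 2013 Thm. 6.1 / §4.2 + Greenberg–Stevens +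
`𝓛_p ≠ 0` + GZK + modularity): Miller's `BSDp W p` contains `ord_p #Ш_an = ord_p #Ш(p)` (finite `Ш`),
whose lower half feeds `mazurMainConjectureAt_of_missingLowerBoundAt_of_red`. Every certified
instance of the rank-`0` BSD formula at such a prime — in particular every X2b census pair closed per
pair — is an instance of Mazur's main conjecture at a multiplicative Eisenstein prime of the OTHER
parity type (`μ > 0` allowed), proved from the published record. [cite: Wuthrich2014, Thm. 16 (p. 397)]
[cite: GreenbergLNM1716, §4 (PDF pp. 112–113) and §5 (closing examples)] [cite: Miller2011LMS, Def. 1.1] -/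
theorem mazurMainConjectureAt_of_bsdp_of_red
    (hWu : thm16_charIdeal_dvd_multiplicative_of_reducible)
    (hJs : thm61_splitMultiplicative) (hJn : thm61_nonsplitMultiplicative)
    (hHs : exists_isSplitMultCanonical) (hHn : exists_isMultCanonical)
    (hGZK : rank_eq_analyticRank_of_analyticRank_le_one) (hmod : hasEntireLFunction_rat)
    (W : WeierstrassCurve ℚ) [W.IsElliptic] [W.IsGloballyMinimal] (p : ℕ) [Fact p.Prime]
    (hGS : greenberg_stevens (W := W) (p := p))
    (hp2 : p ≠ 2) (hmult : W.HasMultiplicativeReductionAtPrime p)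
    (hred : ¬ W.HasIrreducibleModPGaloisRep p) (hr : W.analyticRank = 0) (hbsd : BSDp W p) :
    X2.MazurMainConjectureAt W p := by
  haveI : Finite W.sha := (hGZK W (by rw [hr]; exact zero_le_one)).2
  exact mazurMainConjectureAt_of_missingLowerBoundAt_of_red hWu hJs hJn hHs hHn hGZK hmod W p hGS hp2
    hmult hred hr (lower_and_upper_of_missingPPartAt W p (missingPPartAt_of_bsdp W p hbsd)).1

/-! ### The equivalences at a reducible pair -/

/-- **At an odd multiplicative prime with `E[p]` reducible and `ord_{s=1}L(E,s) = 0`: Mazur's main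
conjecture at `(E,p)` ⟺ `BSD(E,p)`** (⇒: gen 1's `bsdp_of_mazurMainConjectureAt_of_analyticRank_eq_zero`,
needing modularity with a newform datum `hpar`; ⇐: `mazurMainConjectureAt_of_bsdp_of_red`). On X2's
rank-`0` half the typed missing input is therefore EXACT — neither weaker nor stronger than the class
statement. [cite: Wuthrich2014, Thm. 16 (p. 397)] [cite: SteinWuthrich2013, Thm. 6.1 (p. 20)]
[cite: GreenbergLNM1716, §4 (PDF pp. 112–113) and §5 (closing examples)] -/
theorem mazurMainConjectureAt_iff_bsdp_of_red
    (hWu : thm16_charIdeal_dvd_multiplicative_of_reducible)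
    (hJs : thm61_splitMultiplicative) (hJn : thm61_nonsplitMultiplicative)
    (hHs : exists_isSplitMultCanonical) (hHn : exists_isMultCanonical)
    (hGZK : rank_eq_analyticRank_of_analyticRank_le_one) (hmod : hasEntireLFunction_rat)
    (hpar : nonempty_modularParametrizationData)
    (W : WeierstrassCurve ℚ) [W.IsElliptic] [W.IsGloballyMinimal] (p : ℕ) [Fact p.Prime]
    (hGS : greenberg_stevens (W := W) (p := p))
    (hp2 : p ≠ 2) (hmult : W.HasMultiplicativeReductionAtPrime p)
    (hred : ¬ W.HasIrreducibleModPGaloisRep p) (hr : W.analyticRank = 0) :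
    X2.MazurMainConjectureAt W p ↔ BSDp W p :=
  ⟨bsdp_of_mazurMainConjectureAt_of_analyticRank_eq_zero hJs hJn hHs hHn hGZK hmod hpar W p hGS hp2
      hmult hr,
    mazurMainConjectureAt_of_bsdp_of_red hWu hJs hJn hHs hHn hGZK hmod W p hGS hp2 hmult hred hr⟩

/-- **The same with the typed LOWER bound on the right**: at such a pair the three statements —
main conjecture, `BSD(E,p)`, `ord_p #Ш_an ≤ ord_p #Ш` — coincide (the upper-bound half of
`BSD(E,p)` comes with it; independently it is Wuthrich Prop. 21).
[cite: Wuthrich2014, Thm. 16 (p. 397) and Prop. 21 (p. 400)] [cite: GreenbergLNM1716, §4 (PDF pp. 112–113)] -/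
theorem mazurMainConjectureAt_iff_missingLowerBoundAt_of_red
    (hWu : thm16_charIdeal_dvd_multiplicative_of_reducible)
    (hJs : thm61_splitMultiplicative) (hJn : thm61_nonsplitMultiplicative)
    (hHs : exists_isSplitMultCanonical) (hHn : exists_isMultCanonical)
    (hGZK : rank_eq_analyticRank_of_analyticRank_le_one) (hmod : hasEntireLFunction_rat)
    (hpar : nonempty_modularParametrizationData)
    (W : WeierstrassCurve ℚ) [W.IsElliptic] [W.IsGloballyMinimal] (p : ℕ) [Fact p.Prime]
    (hGS : greenberg_stevens (W := W) (p := p))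
    (hp2 : p ≠ 2) (hmult : W.HasMultiplicativeReductionAtPrime p)
    (hred : ¬ W.HasIrreducibleModPGaloisRep p) (hr : W.analyticRank = 0) :
    X2.MazurMainConjectureAt W p ↔ MissingLowerBoundAt W p := by
  constructor
  · intro hMC
    haveI : Finite W.sha := (hGZK W (by rw [hr]; exact zero_le_one)).2
    exact (lower_and_upper_of_missingPPartAt W p (missingPPartAt_of_bsdp W p
      (bsdp_of_mazurMainConjectureAt_of_analyticRank_eq_zero hJs hJn hHs hHn hGZK hmod hpar W p hGS
        hp2 hmult hr hMC))).1
  · exact mazurMainConjectureAt_of_missingLowerBoundAt_of_red hWu hJs hJn hHs hHn hGZK hmod W p hGS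
      hp2 hmult hred hr

/-! ### Class level: the typed input of X2b is EXACT -/

/-- **On a sub-cell X2b (or X2a) pair: Mazur's main conjecture at `(E,p)` ⟺ `BSD(E,p)`** — the cell
predicates unpacked (`CellB W p = (r = 0) ∧ (p ≠ 2 ∧ Red ∧ Mult) ∧ ¬GVPar`; `¬GVPar` is not used).
[cite: Wuthrich2014, Thm. 16 (p. 397)] [cite: GreenbergLNM1716, §4 (PDF pp. 112–113) and §5 (closing examples)] -/
theorem cellB_mazurMainConjectureAt_iff_bsdp
    (hWu : thm16_charIdeal_dvd_multiplicative_of_reducible)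
    (hJs : thm61_splitMultiplicative) (hJn : thm61_nonsplitMultiplicative)
    (hHs : exists_isSplitMultCanonical) (hHn : exists_isMultCanonical)
    (hGZK : rank_eq_analyticRank_of_analyticRank_le_one) (hmod : hasEntireLFunction_rat)
    (hpar : nonempty_modularParametrizationData)
    (W : WeierstrassCurve ℚ) [W.IsElliptic] [W.IsGloballyMinimal] (p : ℕ) [Fact p.Prime]
    (hGS : greenberg_stevens (W := W) (p := p)) (hc : CellB W p) :
    MissingInputB W p ↔ BSDp W p :=
  mazurMainConjectureAt_iff_bsdp_of_red hWu hJs hJn hHs hHn hGZK hmod hpar W p hGS hc.2.1.1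
    hc.2.1.2.2 hc.2.1.2.1 hc.1

/-- **Sub-cell X2b's target of record ⟺ Mazur's main conjecture at every X2b pair** (granted the
PUBLISHED rank-`0` facts): the typed missing input `X2.MissingInputB` of `X2/Cells.lean` is EXACT —
gen 1 proved ⇐ (`targetB_of_missingInputB`), this adds ⇒. So the CONSTRUCTION-SHAPED remainder of
X2 in rank `0` is, in the kernel, precisely "Mazur's main conjecture at a multiplicative Eisenstein
prime of the other parity type" — no weaker statement would do, no stronger one is needed.
[cite: Wuthrich2014, Thm. 16 (p. 397)] [cite: GreenbergLNM1716, §4 (PDF pp. 112–113) and §5 (closing examples)]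
[cite: Skinner2016PacificMC, Thm. A (§1) (conclusion shape)] -/
theorem targetB_iff_forall_cellB_mazurMainConjectureAt
    (hWu : thm16_charIdeal_dvd_multiplicative_of_reducible)
    (hJs : thm61_splitMultiplicative) (hJn : thm61_nonsplitMultiplicative)
    (hHs : exists_isSplitMultCanonical) (hHn : exists_isMultCanonical)
    (hGZK : rank_eq_analyticRank_of_analyticRank_le_one) (hmod : hasEntireLFunction_rat)
    (hpar : nonempty_modularParametrizationData)
    (hGS : ∀ (W : WeierstrassCurve ℚ) [W.IsElliptic] [W.IsGloballyMinimal] (p : ℕ) [Fact p.Prime],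
      greenberg_stevens (W := W) (p := p)) :
    TargetB ↔
      ∀ (W : WeierstrassCurve ℚ) [W.IsElliptic] [W.IsGloballyMinimal] (p : ℕ) [Fact p.Prime],
        CellB W p → MissingInputB W p := by
  constructor
  · intro hT W _ _ p _ hc
    exact (cellB_mazurMainConjectureAt_iff_bsdp hWu hJs hJn hHs hHn hGZK hmod hpar W p (hGS W p)
      hc).mpr (hT W p hc)
  · exact targetB_of_missingInputB hJs hJn hHs hHn hGZK hmod hpar hGS

/-- **The whole rank-`0` half of X2: "`BSD(E,p)` at every rank-`0` X2 pair" ⟺ "Mazur's main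
conjecture at every rank-`0` X2 pair"** (both parity types; on X2a both sides are theorems modulo
the flagged Greenberg–Vatsal fact, gen 1 `targetA_of_published`).
[cite: Wuthrich2014, Thm. 16 (p. 397)] [cite: GreenbergLNM1716, §4 (PDF pp. 112–113) and §5 (closing examples)] -/
theorem forall_rankZero_bsdp_iff_forall_mazurMainConjectureAt
    (hWu : thm16_charIdeal_dvd_multiplicative_of_reducible)
    (hJs : thm61_splitMultiplicative) (hJn : thm61_nonsplitMultiplicative)
    (hHs : exists_isSplitMultCanonical) (hHn : exists_isMultCanonical)
    (hGZK : rank_eq_analyticRank_of_analyticRank_le_one) (hmod : hasEntireLFunction_rat)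
    (hpar : nonempty_modularParametrizationData)
    (hGS : ∀ (W : WeierstrassCurve ℚ) [W.IsElliptic] [W.IsGloballyMinimal] (p : ℕ) [Fact p.Prime],
      greenberg_stevens (W := W) (p := p)) :
    (∀ (W : WeierstrassCurve ℚ) [W.IsElliptic] [W.IsGloballyMinimal] (p : ℕ) [Fact p.Prime],
      W.analyticRank = 0 → ClassX2 W p → BSDp W p) ↔
    (∀ (W : WeierstrassCurve ℚ) [W.IsElliptic] [W.IsGloballyMinimal] (p : ℕ) [Fact p.Prime],
      W.analyticRank = 0 → ClassX2 W p → MazurMainConjectureAt W p) := by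
  constructor
  · intro h W _ _ p _ hr hX
    exact mazurMainConjectureAt_of_bsdp_of_red hWu hJs hJn hHs hHn hGZK hmod W p (hGS W p) hX.1
      hX.2.2 hX.2.1 hr (h W p hr hX)
  · intro h W _ _ p _ hr hX
    exact bsdp_of_mazurMainConjectureAt_of_analyticRank_eq_zero hJs hJn hHs hHn hGZK hmod hpar W p
      (hGS W p) hX.1 hX.2.2 hr (h W p hr hX)

/-! ### Per-pair main-conjecture certificates from the published record -/

/-- **Mazur's main conjecture at every rank-`0`, odd, multiplicative, `E[p]`-reducible pair with
`p ∤ #Ш(E/ℚ)_an`** — BOTH parity types, `p = 3` included. Wuthrich 2014 Prop. 21 (`hW21`) closes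
`BSD(E,p)` there (`Wuthrich2014.bsdp_of_L_one_ne_zero_of_padicValRat_shaAn_eq_zero`), and the
converse chain turns it into the main conjecture at the pair. At an X2b pair whose curve carries a
ramified-odd rational line the certified main conjecture has `μ(X) ≥ 1` (Greenberg 1999 Prop. 5.7,
tree fact `Greenberg1999.prop57_one_le_mu_of_ramified_odd_line`), i.e. `p ∣ L_p(E)`: `X₀(11)@5`-type
main conjectures at `p ‖ N`, from the published record, pair by pair.
[cite: Wuthrich2014, Prop. 21 (p. 400) and Thm. 16 (p. 397)]
[cite: GreenbergLNM1716, §4 (PDF pp. 112–113), §5 (closing examples), Prop. 5.7] -/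
theorem mazurMainConjectureAt_of_shaAn_unit_of_red
    (hWu : thm16_charIdeal_dvd_multiplicative_of_reducible) (hW21 : sha_dvd_analyticSha)
    (hJs : thm61_splitMultiplicative) (hJn : thm61_nonsplitMultiplicative)
    (hHs : exists_isSplitMultCanonical) (hHn : exists_isMultCanonical)
    (hGZK : rank_eq_analyticRank_of_analyticRank_le_one) (hmod : hasEntireLFunction_rat)
    (W : WeierstrassCurve ℚ) [W.IsElliptic] [W.IsGloballyMinimal] (p : ℕ) [Fact p.Prime]
    (hGS : greenberg_stevens (W := W) (p := p))
    (hp2 : p ≠ 2) (hmult : W.HasMultiplicativeReductionAtPrime p)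
    (hred : ¬ W.HasIrreducibleModPGaloisRep p) (hr : W.analyticRank = 0)
    (hunit : ∃ q : ℚ, shaAn W = (q : ℂ) ∧ padicValRat p q = 0) :
    X2.MazurMainConjectureAt W p :=
  mazurMainConjectureAt_of_bsdp_of_red hWu hJs hJn hHs hHn hGZK hmod W p hGS hp2 hmult hred hr
    (Wuthrich2014.bsdp_of_L_one_ne_zero_of_padicValRat_shaAn_eq_zero hW21 hGZK W p hp2
      ((W.analyticRank_eq_zero_iff_holds (hmod W)).1 hr)
      (WeierstrassCurve.HasMultiplicativeReduction.not_hasAdditiveReduction _ hmult) (Or.inl hred)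
      hunit)

/-- The same on a sub-cell X2b pair (cell predicates unpacked). Census (values only, X2-GAP.md §5,
§8): every X2b pair `N < 2·10⁴` (688) is closed per pair, those with `p ∤ #Ш_an` by exactly this
certificate. [cite: Wuthrich2014, Prop. 21 (p. 400) and Thm. 16 (p. 397)]
[cite: GreenbergLNM1716, §4 (PDF pp. 112–113) and §5 (closing examples)] -/
theorem mazurMainConjectureAt_of_cellB_of_shaAn_unit
    (hWu : thm16_charIdeal_dvd_multiplicative_of_reducible) (hW21 : sha_dvd_analyticSha)
    (hJs : thm61_splitMultiplicative) (hJn : thm61_nonsplitMultiplicative)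
    (hHs : exists_isSplitMultCanonical) (hHn : exists_isMultCanonical)
    (hGZK : rank_eq_analyticRank_of_analyticRank_le_one) (hmod : hasEntireLFunction_rat)
    (W : WeierstrassCurve ℚ) [W.IsElliptic] [W.IsGloballyMinimal] (p : ℕ) [Fact p.Prime]
    (hGS : greenberg_stevens (W := W) (p := p)) (hc : CellB W p)
    (hunit : ∃ q : ℚ, shaAn W = (q : ℂ) ∧ padicValRat p q = 0) : MissingInputB W p :=
  mazurMainConjectureAt_of_shaAn_unit_of_red hWu hW21 hJs hJn hHs hHn hGZK hmod W p hGS hc.2.1.1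
    hc.2.1.2.2 hc.2.1.2.1 hc.1 hunit

/-- **On a sub-cell X2b pair the missing input is the LOWER bound alone**:
`BSDp W p ↔ Typed.MissingLowerBoundAt W p` (`ord_p #Ш(E/ℚ)_an ≤ ord_p #Ш(E/ℚ)`), the upper bound
being Wuthrich 2014 Prop. 21 (`hW21`; `Typed.bsdp_of_missingLowerBoundAt_of_wuthrich`) — and by
`mazurMainConjectureAt_iff_missingLowerBoundAt_of_red` all three (MC, `BSD(E,p)`, lower bound)
coincide there. [cite: Wuthrich2014, Prop. 21 (p. 400)] [cite: Miller2011LMS, Def. 1.1] -/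
theorem cellB_bsdp_iff_missingLowerBoundAt (hW21 : sha_dvd_analyticSha)
    (hGZK : rank_eq_analyticRank_of_analyticRank_le_one) (hmod : hasEntireLFunction_rat)
    {W : WeierstrassCurve ℚ} [W.IsElliptic] [W.IsGloballyMinimal] {p : ℕ} [Fact p.Prime]
    (hc : CellB W p) : BSDp W p ↔ MissingLowerBoundAt W p := by
  constructor
  · intro h
    haveI : Finite W.sha := (hGZK W (by rw [hc.1]; exact zero_le_one)).2
    exact (lower_and_upper_of_missingPPartAt W p (missingPPartAt_of_bsdp W p h)).1
  · intro hlow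
    exact bsdp_of_missingLowerBoundAt_of_wuthrich W p hW21 hGZK hmod hc.2.1.1 hc.1
      (WeierstrassCurve.HasMultiplicativeReduction.not_hasAdditiveReduction _ hc.2.1.2.2)
      (Or.inl hc.2.1.2.1) hlow

end Summit.BirchSwinnertonDyer.Rank1Residual.X2

end
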